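import Summits.QuantumFields.YangMills.Theorems.BalabanUVNodesN06SectBStepUParKnitFull
import Literature.MathematicalPhysics.QuantumFieldTheory.Balaban1983to89.B9LeafXCodedKnitUParH
import Literature.MathematicalPhysics.QuantumFieldTheory.Balaban1983to89.Node00.OpsYQLetter
import Literature.MathematicalPhysics.QuantumFieldTheory.Balaban1983to89.B7AvgClosedSpecialUnitarySharp
import Literature.MathematicalPhysics.QuantumFieldTheory.Balaban1983to89.B9PinGeometryKLevelV1B

/-!
# Balaban UV-stability nodes, N06 [B9] Sect. B — «K2-G-KNIT-REC»: THE KNIT SECT.-B STEP AT THE STAGE RECORD — `G := SU(N)` (`N ≦ 25`), `c35 := c35Y`,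
# the averaging pair OF RECORD `(qKnitOfRecord, qsKnitOfRecord)`, the record-level Thm 3.3 — i.e. the knit certificate's `hBK` binder shape
# `h32 → h33 → SectBStepUPar …` with the class token `C37KY` (dag-n06-d «KA» l.111 displays it at `C37GY`)

[B9] = T. Bałaban, *Propagators for lattice gauge theories in a background field*, Commun. Math. Phys. **99** (1985) 389–434 [`Balaban1985BackgroundPropagators`];
[B8] = T. Bałaban, *Averaging operations for lattice gauge theories*, Commun. Math. Phys. **98** (1985) 17–51 [`Balaban1985Averaging`]; [4] = [`Balaban1984PropagatorsII`].

statement-level skeleton of published theorems with citation tags; proofs where landed; nothing here is a claim about the Yang–Mills mass gap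

THE PRINT.  Thm 3.4 p. 400 (Sect.-B step for the pair `(U, U′)` of (3.35)–(3.37)); (3.19) p. 393 (the averaging's transporters are those of [B8] (52)–(53)); Thms 3.2∕3.3 pp.
398–399 (the inputs); Thm 3.11 p. 416 (invertibility of `Δ_a`).

WHAT (seat dag-n06-c gen 26).  `…N06SectBStepUParKnitFull.sectBStepUPar_knit` READ AT THE STAGE RECORD: `G := specialUnitaryUnits (Fin N)` with `hGa := avgClosed_specialUnitary_of_le hN`
(`N ≦ 25` — the tree's range for [B8]'s averaging closure of `SU(N)`, refuted beyond), `hGU := specialUnitaryUnits_le_unitaryUnits`, `c35 := c35Y` (`hc := c35Y_le_ten`), the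
averaging pair `(𝔮, 𝔮s) := (qKnitOfRecord N θ _, qsKnitOfRecord N θ _)` (faces `qKnitOfRecord_apply ∕ qsKnitOfRecord_apply`, `rfl`), the regime bridge `hRP` from the coded
class `(bg9YC 𝕄 SU(N) extraYPb x).Reg335 c35Y` to the local class `(bg9KP 𝕄 SU(N) x.toKIdx).Reg335 c35Y` (`B9SectBCodedClassR.reg335C_iff` + `bg9YP`'s first conjunct — the
reading dag-n06-j uses in `hunitAQ_knitRecord_of_sections`), `hb₁ := θ.hb`, and the CODED Theorem 3.3 DERIVED from the record-level one by dag-n06-d's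
`B9LeafXCodedKnitUParH.thm33Printed_codedUPar` — so the two antecedents `h32 ∕ h33` are LITERALLY those of «KA»'s `hBK` (l.111).  DISPLAYED: `hN`, `hι`, the basis data
`M₂ hrepr hcR hcL`, the x-free numerics windows (`α₀′ ≦ α_Q`, `8α₀′ ≦ c₂′`, `K_pl(a)·L⁴ < α₀′` on `a ≦ aInv`, dag-n06-l's Prop-7 `ϱ′∕ϱ` window), the thresholds
`MInv aInv aW mN` (`hMd hMr hnbr`), the class constants `CqK MK` (`0 ≦ CqK`; `CqK` stays a binder until dag-n06-l's (K1) names its constant — node00-def-Y I.20728), and the GUARDED knit Thm 3.11 unit `hunitA` (n06-j's `hunitAQ_knitRecord_of_sections` supplies it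
on its own thresholds; «KA» displays the positivity `hΔAK` from which it follows by `isUnit_of_posDefTr` — the fold is the certificate's, so it stays a binder here).

HONEST SCOPE.  Instantiation ∕ bookkeeping of landed theorems at the record's names; conditional on `hunitA`, `h32`, `h33`, the numerics and `N ≦ 25`; a HELPER — it inhabits
«KA»'s `hBK` only after the class token there is re-keyed `C37GY → C37KY` (dag-n06-d's ∕ node00-def-Y's call); NOT the discharge of any N06 obligation; count-neutral;
nothing continuum ∕ OS ∕ mass gap ∕ Clay.  Cell `pub-ymgap` (HUMAN RULING D-0062), Track A node N06 [B9], 2026-08-30.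
-/

noncomputable section

namespace Summit.QuantumFields.YangMills.BalabanUVNodes.N06SectBStepUParKnitRecord

open scoped Matrix Matrix.Norms.L2Operator
open Literature.MathematicalPhysics.QuantumFieldTheory.Balaban1983to89
open Literature.MathematicalPhysics.QuantumFieldTheory.Balaban1983to89.Node00 (SiteY BlkY FBondY IBondY CfgY SiteParY GAQY GpY XY deltaAQY deltaPrimeAY parSymY parBY
  kernelFamilyS kernelFamilyB Stage3Params)
open Literature.MathematicalPhysics.QuantumFieldTheory.Balaban1983to89.Node00.OpsYQLetter (adjTrY qKnitOfRecord qsKnitOfRecord)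
open Literature.MathematicalPhysics.QuantumFieldTheory.Balaban1983to89.Node00 (cqY)
open Literature.MathematicalPhysics.QuantumFieldTheory.Balaban1983to89.B6Ineq2142KLevelV1 (β)
open Literature.MathematicalPhysics.QuantumFieldTheory.Balaban1983to89.B6KLevelCensusIndexV1 (KIdx kGeo)
open Literature.MathematicalPhysics.QuantumFieldTheory.Balaban1983to89.B9PinMembersKLevelV1 (MemberY geo9Y)
open Literature.MathematicalPhysics.QuantumFieldTheory.Balaban1983to89.B9PinGeometryKLevelV1 (c35Y)
open Literature.MathematicalPhysics.QuantumFieldTheory.Balaban1983to89.B9PinGeometryKLevelV1B (c35Y_le_ten)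
open Literature.MathematicalPhysics.QuantumFieldTheory.Balaban1983to89.B9BackgroundsKLevelV1P (bg9KP)
open Literature.MathematicalPhysics.QuantumFieldTheory.Balaban1983to89.B9SectBCodedClassR (RegExtraY bg9YC extraYPb)
open Literature.MathematicalPhysics.QuantumFieldTheory.Balaban1983to89.B9Eq360DeltaPrimeAY (AfldY)
open Literature.MathematicalPhysics.QuantumFieldTheory.Balaban1983to89.B9SectBGpFrameCodedYR (codingYx)
open Literature.MathematicalPhysics.QuantumFieldTheory.Balaban1983to89.B9SectBCodedReadingsUR (KACU)
open Literature.MathematicalPhysics.QuantumFieldTheory.Balaban1983to89.B9SectBCodedReadingsUParH (KSCUPar SectBStepUPar)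
open Literature.MathematicalPhysics.QuantumFieldTheory.Balaban1983to89.B9SectBKerFrameCodedYR (CinvY)
open Literature.MathematicalPhysics.QuantumFieldTheory.Balaban1983to89.B9RWSumsReadsNbr (nbr)
open Literature.MathematicalPhysics.QuantumFieldTheory.Balaban1983to89.B9Eq340TaxiContourLocalityY (rLB)
open Literature.MathematicalPhysics.QuantumFieldTheory.Balaban1983to89.B9SectBCodedClassKnitY (C37KY)
open Literature.MathematicalPhysics.QuantumFieldTheory.Balaban1983to89.B7Prop2Explicit (unitaryUnits c2')
open Literature.MathematicalPhysics.QuantumFieldTheory.Balaban1983to89.B7Prop2SpecialUnitary (specialUnitaryUnits specialUnitaryUnits_le_unitaryUnits)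
open Literature.MathematicalPhysics.QuantumFieldTheory.Balaban1983to89.B7AvgClosedSpecialUnitarySharp (avgClosed_specialUnitary_of_le)
open Literature.MathematicalPhysics.QuantumFieldTheory.Balaban1983to89.B7Prop3Flat (c3)
open Literature.MathematicalPhysics.QuantumFieldTheory.Balaban1983to89.B7Prop5CplxLevels (epsCplx tauCplx)
open Literature.MathematicalPhysics.QuantumFieldTheory.Balaban1983to89.B9Eq316AveragingTransposeZd (alphaQ)
open Literature.MathematicalPhysics.QuantumFieldTheory.Balaban1983to89.B9C2FormBoxRegimeY (Kpl)
open Literature.MathematicalPhysics.QuantumFieldTheory.Balaban1983to89.B9B8AveragingJunction (parKnitY)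
open Literature.MathematicalPhysics.QuantumFieldTheory.Balaban1983to89.B9LeafXCodedKnitUParH (thm33Printed_codedUPar)
open Summit.QuantumFields.YangMills.BalabanUVNodes.N06SectBStepUParKnitFull (sectBStepUPar_knit)

variable {N : ℕ} [NeZero N] [Nonempty (Fin N)] (θ : Stage3Params) (Mstar : ℕ)
variable {ι : Type} [Fintype ι] [DecidableEq ι]
variable {J : Type} (f : J → MemberY θ.d₆ θ.ℓ₆ θ.hd' θ.hL' θ.b₀ θ.b₁ Mstar)
  [∀ x : MemberY θ.d₆ θ.ℓ₆ θ.hd' θ.hL' θ.b₀ θ.b₁ Mstar, Fintype (geo9Y x).Site]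
  [instDS : ∀ x : MemberY θ.d₆ θ.ℓ₆ θ.hd' θ.hL' θ.b₀ θ.b₁ Mstar, DecidableEq (geo9Y x).Site]
  [instNE : ∀ x : MemberY θ.d₆ θ.ℓ₆ θ.hd' θ.hL' θ.b₀ θ.b₁ Mstar, Nonempty (geo9Y x).Site]
  (b : Module.Basis ι ℝ (Matrix (Fin N) (Fin N) ℂ)) (ιB : ∀ j : J, BlkY (f j).toKIdx → IBondY (f j).toKIdx)
  (C38 : ∀ j : J, ℝ → CfgY (Matrix (Fin N) (Fin N) ℂ) (f j).toKIdx → AfldY (Matrix (Fin N) (Fin N) ℂ) (f j).toKIdx → Prop)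
  (CqK MK aInv : ℝ)

/-- ★★★ **THE KNIT SECT.-B STEP AT THE STAGE RECORD** (`G := SU(N)`, `N ≦ 25`; `c35 := c35Y`; the averaging pair of record; `P := extraYPb`; class `C37KY` pinned to the coded
regularity `(bg9YC 𝕄 SU(N) extraYPb x).Reg335 c35Y`, straight constant `Cq := cqY d₆` (node00-def-Y's word I.20728), exponent window
`β₀ := ϱ′·L³∕3`, the knit constant `CqK` and the thresholds `MK ∕ aInv` binders): from the record's Theorem 3.2 `h32` and the record-level Theorem 3.3 `h33` for
`(G′, G) = (GpY parKnitY, G[𝔮_rec](parKnitY, G′))` read by `kernelFamilyS … parSymY ∕ kernelFamilyB … parBY` — the two antecedents of «KA»'s `hBK` — plus the GUARDED knit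
Thm 3.11 unit `hunitA`, the numerics windows and the basis data, the two-transporter Sect.-B step over the coded carrier at the knit.  Everything else is discharged by name in
`sectBStepUPar_knit` (gen 26) and its companions. [cite: Balaban1985BackgroundPropagators, Thm 3.4 p.400, Sect. B pp.400–407, (3.19) p.393, (3.35)–(3.37) p.396, Thms 3.2–3.3 pp.398–399, Thm 3.11 p.416; Balaban1985Averaging, Prop. 2 p.26, Prop. 7 p.43; Balaban1984PropagatorsII, Lemma 2.1 p.234] -/
theorem sectBStepUPar_knitRecord [NormOneClass (Matrix (Fin N) (Fin N) ℂ)] [FiniteDimensional ℝ (Matrix (Fin N) (Fin N) ℂ)] (hN : N ≤ 25)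
    (hι : ∀ (j : J) (s : BlkY (f j).toKIdx), β (f j).toKIdx.hN (f j).toKIdx.D (f j).toKIdx.hk (ιB j s) = s)
    (M₂ : ℝ) (hM₂ : 0 ≤ M₂) (hrepr : ∀ (v : Matrix (Fin N) (Fin N) ℂ) (j : ι), |b.repr v j| ≤ M₂ * ‖v‖) (hcR : 0 < M₂ * ∑ j, ‖b j‖)
    (hcL : 0 < Real.sqrt (Fintype.card ι) * M₂ * ∑ j, ‖b j‖)
    (hCqK : 0 ≤ CqK) (MInv aW : ℝ) (hMInv : 0 < MInv) (haInv : 0 < aInv) (haW : 0 < aW)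
    {α₀' : ℝ} (hα' : 0 < α₀') (hαQ : α₀' ≤ alphaQ (θ.d₆ + 1) (θ.ℓ₆ + 1)) (hα8 : 8 * α₀' ≤ c2' (θ.d₆ + 1) (θ.ℓ₆ + 1))
    (hKpl : ∀ (j : J) (a : ℝ), 0 ≤ a → a ≤ aInv → Kpl (f j).toKIdx a * (kGeo (f j).toKIdx).L ^ 4 < α₀')
    {ϱ' ϱ : ℝ} (hϱ' : 0 < ϱ') (hϱ : 0 < ϱ)
    (hsmall' : Real.exp (4 * (800 * (((θ.d₆ + 1 : ℕ) : ℝ) + 1) ^ 2 * (((θ.d₆ + 1 : ℕ) : ℝ) + 4)) * α₀')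
      * (1 + 8 * (131072 * (((θ.d₆ + 1 : ℕ) : ℝ) + 1) ^ 2) * ϱ') ≤ 2)
    (hc₃' : 2 * ϱ' ≤ c3 (θ.d₆ + 1) (θ.ℓ₆ + 1)) (hϱ'1 : 409600 * (((θ.d₆ + 1 : ℕ) : ℝ) + 1) ^ 2 * ϱ' ≤ 1)
    (hE : epsCplx (θ.d₆ + 1) (θ.ℓ₆ + 1) ϱ' 0 ≤ 1 / 16)
    (hdX : ((θ.d₆ + 1 : ℕ) : ℝ) * (epsCplx (θ.d₆ + 1) (θ.ℓ₆ + 1) ϱ' 0 + tauCplx (θ.d₆ + 1) (θ.ℓ₆ + 1) α₀' 0 ϱ' 0) ≤ 1 / 16)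
    (hsmall : Real.exp (4480 * (((θ.d₆ + 1 : ℕ) : ℝ) + 1) ^ 2 * (((θ.d₆ + 1 : ℕ) : ℝ) + 4) * α₀' + 240000 * (((θ.d₆ + 1 : ℕ) : ℝ) + 1) ^ 3 * ϱ')
      * (1 + 8 * (2097152 * (((θ.d₆ + 1 : ℕ) : ℝ) + 1) ^ 2) * ϱ) ≤ 2)
    (hc₃ : 2 * ϱ ≤ c3 (θ.d₆ + 1) (θ.ℓ₆ + 1) / 4)
    (hunitA : ∀ j (α₀ : ℝ) (U : CfgY (Matrix (Fin N) (Fin N) ℂ) (f j).toKIdx), MInv ≤ (geo9Y (f j)).M → 0 < α₀ → (geo9Y (f j)).M * α₀ ≤ aInv →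
      (bg9YC (Matrix (Fin N) (Fin N) ℂ) (specialUnitaryUnits (Fin N)) (extraYPb (Matrix (Fin N) (Fin N) ℂ) (specialUnitaryUnits (Fin N))) (f j)).Reg335 c35Y α₀ U →
      IsUnit (deltaAQY (f j).toKIdx (qKnitOfRecord N θ (f j).toKIdx) (qsKnitOfRecord N θ (f j).toKIdx) (parKnitY (f j).toKIdx)
        (GpY (f j).toKIdx (parKnitY (f j).toKIdx)) U))
    (hMd : 2 * ((θ.d₆ : ℝ) + 1) < MInv) (mN : ℕ) (hnbr : ∀ (j : J) (y' : IBondY (f j).toKIdx), (nbr (geo9Y (f j)) (2 * ((θ.d₆ : ℝ) + 1)) y').card ≤ mN)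
    (hMr : rLB θ.d₆ θ.ℓ₆ + 1 < MInv)
    (h32 : B9.Thm32Printed (θ.d₆ + 1) c35Y (fun j => geo9Y (f j))
      (fun j => bg9YC (Matrix (Fin N) (Fin N) ℂ) (specialUnitaryUnits (Fin N)) (extraYPb (Matrix (Fin N) (Fin N) ℂ) (specialUnitaryUnits (Fin N))) (f j))
      (CinvY (extraYPb (Matrix (Fin N) (Fin N) ℂ) (specialUnitaryUnits (Fin N))) f (specialUnitaryUnits (Fin N)) (fun j => parKnitY (f j).toKIdx)))
    (h33 : B9.Thm33Printed c35Y (fun j => geo9Y (f j))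
      (fun j => bg9YC (Matrix (Fin N) (Fin N) ℂ) (specialUnitaryUnits (Fin N)) (extraYPb (Matrix (Fin N) (Fin N) ℂ) (specialUnitaryUnits (Fin N))) (f j))
      (fun j => kernelFamilyS (f j).toKIdx
        (bg9YC (Matrix (Fin N) (Fin N) ℂ) (specialUnitaryUnits (Fin N)) (extraYPb (Matrix (Fin N) (Fin N) ℂ) (specialUnitaryUnits (Fin N))) (f j)) (fun U => U)
        (GpY (f j).toKIdx (parKnitY (f j).toKIdx)) (parSymY (f j).toKIdx))
      (fun j => kernelFamilyB (f j).toKIdx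
        (bg9YC (Matrix (Fin N) (Fin N) ℂ) (specialUnitaryUnits (Fin N)) (extraYPb (Matrix (Fin N) (Fin N) ℂ) (specialUnitaryUnits (Fin N))) (f j)) (fun U => U)
        (GAQY (f j).toKIdx (qKnitOfRecord N θ (f j).toKIdx) (qsKnitOfRecord N θ (f j).toKIdx) (parKnitY (f j).toKIdx) (GpY (f j).toKIdx (parKnitY (f j).toKIdx)))
        (parBY (f j).toKIdx))) :
    SectBStepUPar (extraYPb (Matrix (Fin N) (Fin N) ℂ) (specialUnitaryUnits (Fin N))) f (θ.d₆ + 1) c35Y (specialUnitaryUnits (Fin N)) b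
      (fun j => parKnitY (f j).toKIdx) (fun j => parSymY (f j).toKIdx)
      (fun j => GAQY (f j).toKIdx (qKnitOfRecord N θ (f j).toKIdx) (qsKnitOfRecord N θ (f j).toKIdx) (parKnitY (f j).toKIdx) (GpY (f j).toKIdx (parKnitY (f j).toKIdx)))
      (fun j => parBY (f j).toKIdx)
      (fun j => C37KY (specialUnitaryUnits (Fin N)) (f j) (ιB j)
        (fun α₀ U => (bg9YC (Matrix (Fin N) (Fin N) ℂ) (specialUnitaryUnits (Fin N)) (extraYPb (Matrix (Fin N) (Fin N) ℂ) (specialUnitaryUnits (Fin N))) (f j)).Reg335 c35Y α₀ U)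
        (cqY θ.d₆) CqK MK aInv (ϱ' * (((θ.ℓ₆ + 1 : ℕ) : ℝ)) ^ 3 / 3))
      C38 (CinvY (extraYPb (Matrix (Fin N) (Fin N) ℂ) (specialUnitaryUnits (Fin N))) f (specialUnitaryUnits (Fin N)) (fun j => parKnitY (f j).toKIdx)) := by
  have hb₁ : 0 ≤ θ.b₁ := θ.hb.1.le.trans θ.hb.2
  have hL0 : (0 : ℝ) < (((θ.ℓ₆ + 1 : ℕ) : ℝ)) := by positivity
  have hβ₀ : 3 * (((((θ.ℓ₆ + 1 : ℕ) : ℝ)) ^ 3)⁻¹ * (ϱ' * (((θ.ℓ₆ + 1 : ℕ) : ℝ)) ^ 3 / 3)) ≤ ϱ' := by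
    have : 3 * (((((θ.ℓ₆ + 1 : ℕ) : ℝ)) ^ 3)⁻¹ * (ϱ' * (((θ.ℓ₆ + 1 : ℕ) : ℝ)) ^ 3 / 3)) = ϱ' := by field_simp
    rw [this]
  -- the regime bridge: the coded class of record is print's class with `0 ≤ α₀`; its first conjunct is the local class at the member's own index
  have hRP : ∀ (j : J) (α₀ : ℝ) (U : CfgY (Matrix (Fin N) (Fin N) ℂ) (f j).toKIdx),
      (bg9YC (Matrix (Fin N) (Fin N) ℂ) (specialUnitaryUnits (Fin N)) (extraYPb (Matrix (Fin N) (Fin N) ℂ) (specialUnitaryUnits (Fin N))) (f j)).Reg335 c35Y α₀ U →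
        (bg9KP (Matrix (Fin N) (Fin N) ℂ) (specialUnitaryUnits (Fin N)) (f j).toKIdx).Reg335 c35Y α₀ U :=
    fun j α₀ U hU => ⟨hU.1.1, hU.1.2.2⟩
  exact sectBStepUPar_knit f c35Y (specialUnitaryUnits (Fin N)) (fun j => qKnitOfRecord N θ (f j).toKIdx) (fun j => qsKnitOfRecord N θ (f j).toKIdx) b ιB C38
    (cqY θ.d₆) CqK MK aInv (ϱ' * (((θ.ℓ₆ + 1 : ℕ) : ℝ)) ^ 3 / 3) hι (avgClosed_specialUnitary_of_le hN (θ.d₆ + 1) (θ.ℓ₆ + 1)) specialUnitaryUnits_le_unitaryUnits M₂ hM₂ hrepr hcR hcL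
    (fun j U => rfl) (fun j U => rfl) hCqK MInv aW hMInv haInv haW c35Y_le_ten hRP hα' hαQ hα8 hKpl hϱ' hϱ hsmall' hc₃' hϱ'1 hE hdX hsmall hc₃ hβ₀
    hunitA hb₁ hMd mN hnbr hMr h32
    (thm33Printed_codedUPar (extraYPb (Matrix (Fin N) (Fin N) ℂ) (specialUnitaryUnits (Fin N))) (specialUnitaryUnits (Fin N)) f C38
      (fun j => parKnitY (f j).toKIdx) (fun j => parSymY (f j).toKIdx)
      (fun j => GAQY (f j).toKIdx (qKnitOfRecord N θ (f j).toKIdx) (qsKnitOfRecord N θ (f j).toKIdx) (parKnitY (f j).toKIdx) (GpY (f j).toKIdx (parKnitY (f j).toKIdx)))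
      (fun j => parBY (f j).toKIdx) c35Y _ h33)

end Summit.QuantumFields.YangMills.BalabanUVNodes.N06SectBStepUParKnitRecord

end
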